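import Literature.Topology.FourManifolds.IsotopyExtensionCorners
import Literature.Topology.FourManifolds.SphereFamilySurgery
import Literature.Topology.FourManifolds.ImmersionCriterion
import Literature.Topology.FourManifolds.KnotFraming
import Literature.Topology.FourManifolds.CollarTheorem
import Literature.Topology.FourManifolds.DiffeotopyProofs
import HarnessLib

/-!
# Isotopies of finite disjoint families and their ambient extension

Topic `Literature/Topology/FourManifolds`; infrastructure for handle slides of `2`-handles
(brick G4-link of the roadmap in `PresentationHandlebodyFiveProofs.lean`): an isotopy of a
*link* — a finite family of pairwise disjoint embedded circles — is to be covered by ONE ambient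
isotopy of the surrounding closed manifold.

A finite family `e i : M → N`, `i : ι`, of smooth embeddings of a compact manifold `M` with
pairwise disjoint images is the same thing as one smooth embedding of the disjoint sum
`M + ⋯ + M`, which the tree writes as the product manifold `DiscreteIndex ι × M` of
`SphereFamilySurgery.lean` (`ι` with the discrete topology, charted on `ℝ⁰`).  We prove:

* `Literature.Topology.FourManifolds.contMDiff_familyMap`,
  `Literature.Topology.FourManifolds.injective_mfderiv_familyMap`,
  `Literature.Topology.FourManifolds.isSmoothEmbedding_familyMap` — the glued map
  `(i, x) ↦ e i x` is smooth, has injective differential, and (for embeddings with pairwise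
  disjoint images, `M` compact, `N` Hausdorff, both without boundary and finite-dimensional) is a
  smooth embedding (immersion criterion `isSmoothEmbedding_of_injective_of_injective_mfderiv`,
  `ImmersionCriterion.lean`, and `Manifold.IsImmersionAtOfComplement.mfderiv_injective`,
  `KnotFraming.lean`);
* `Literature.Topology.FourManifolds.exists_smoothIsotopy_familyMap` — a family of smooth
  isotopies `F i` from `e₀ i` to `e₁ i` whose stages are pairwise disjoint at every time glues to a
  smooth isotopy of `DiscreteIndex ι × M` (`Literature.Topology.FourManifolds.SmoothIsotopy`);
* `Literature.Topology.FourManifolds.exists_ambientIsotopy_of_smoothIsotopy_family` — hence, by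
  the isotopy extension theorem in the tree's unconditional form
  (`SmoothIsotopy.exists_ambientIsotopy_comp_eq_holds`, `IsotopyExtensionCorners.lean`; Hirsch,
  Ch. 8 §1, Thm. 1.3), such a family in a closed manifold `N` is covered by an ambient isotopy
  `Ψ` of `N`: `Ψ_t ∘ e₀ i = F i t` for all `i` and `-1/2 < t < 3/2`, in particular
  `Ψ_1 ∘ e₀ i = e₁ i` (`…_one_comp`);
* `Literature.Topology.FourManifolds.BoundaryData.exists_diffeomorph_comp_incl_of_smoothIsotopy_family`
  — when `N = ∂W` is the boundary manifold of a compact manifold with boundary `W` (a boundary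
  datum `b : BoundaryData (𝓡∂ (n + 1)) W (𝓡 n)`), the time-one map `ψ = Ψ_1` is diffeotopic to
  the identity (`AmbientIsotopy.isDiffeotopicToId`, `DiffeotopyProofs.lean`), hence extends over
  `W` through a collar (`BoundaryData.diffeoExtends_of_isDiffeotopicToId_holds`,
  `CollarTheorem.lean`; Kosinski VI §7, proof of (7.2): *"extended over `M`, using the collar of
  `∂M`, in the usual way"*): there is a diffeomorphism `Φ` of `W` with `Φ ∘ incl = incl ∘ ψ` and
  `ψ ∘ e₀ i = e₁ i` — the form in which an isotopy of attaching spheres is used in handle theory.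

Everything here is proved; no named facts are introduced.

## References

* M. W. Hirsch, *Differential Topology*, GTM 33, Springer (1976), Ch. 8 §1, Thm. 1.3 (isotopy
  extension for compact submanifolds; a compact submanifold may have several components).
  [HirschDT1976]
* J. W. Milnor, *Lectures on the h-cobordism theorem*, Princeton (1965), §3 (PDF p. 21: disjoint
  sums of attaching spheres). [MilnorHCobordism1965]
* A. A. Kosinski, *Differential Manifolds*, Academic Press (1993), VI §7, proof of (7.2).
  [Kosinski1993]
-/

open scoped Manifold ContDiff Topology
open Function Set

noncomputable section

namespace Literature.Topology.FourManifolds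

universe u

variable {EM HM EN HN : Type*} [NormedAddCommGroup EM] [NormedSpace ℝ EM] [TopologicalSpace HM]
  [NormedAddCommGroup EN] [NormedSpace ℝ EN] [TopologicalSpace HN]
  {I : ModelWithCorners ℝ EM HM} {J : ModelWithCorners ℝ EN HN}
  {M : Type*} [TopologicalSpace M] [ChartedSpace HM M]
  {N : Type*} [TopologicalSpace N] [ChartedSpace HN N]
  {ι : Type*}

/-! ### The glued map of a family -/

section Glue

omit [TopologicalSpace N] in
/-- **Local form of the glued map.** Near `(i, x)` the glued map `(j, y) ↦ e j y` of a family is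
the `i`-th member composed with the second projection (the slice `{i} × M` is open).
[folklore] -/
theorem familyMap_eventuallyEq (e : ι → M → N) (i : DiscreteIndex ι) (x : M) :
    (fun p : DiscreteIndex ι × M => e (DiscreteIndex.mk.symm p.1) p.2) =ᶠ[𝓝 (i, x)]
      (e (DiscreteIndex.mk.symm i) ∘ Prod.snd) := by
  have ho : IsOpen (Prod.fst ⁻¹' {i} : Set (DiscreteIndex ι × M)) :=
    (isOpen_discrete _).preimage continuous_fst
  filter_upwards [ho.mem_nhds (by simp)] with p hp
  obtain ⟨j, y⟩ := p
  simp only [mem_preimage, mem_singleton_iff] at hp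
  subst hp
  rfl

/-- **The glued map of a smooth family is smooth** on the product manifold
`DiscreteIndex ι × M`. [folklore] -/
theorem contMDiff_familyMap {n : WithTop ℕ∞} {e : ι → M → N} (he : ∀ i, ContMDiff I J n (e i)) :
    ContMDiff ((𝓡 0).prod I) J n
      (fun p : DiscreteIndex ι × M => e (DiscreteIndex.mk.symm p.1) p.2) := by
  rintro ⟨i, x⟩
  exact ((he _).comp contMDiff_snd).contMDiffAt.congr_of_eventuallyEq
    (familyMap_eventuallyEq e i x)

/-- **Joint smoothness of a glued family of homotopies**: if each `(t, x) ↦ F i t x` is smooth,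
so is `(t, (i, x)) ↦ F i t x`. [folklore] -/
theorem contMDiff_uncurry_familyMap {n : WithTop ℕ∞} {F : ι → ℝ → M → N}
    (hF : ∀ i, ContMDiff (𝓘(ℝ, ℝ).prod I) J n (uncurry (F i))) :
    ContMDiff (𝓘(ℝ, ℝ).prod ((𝓡 0).prod I)) J n
      (uncurry fun (t : ℝ) (p : DiscreteIndex ι × M) => F (DiscreteIndex.mk.symm p.1) t p.2) := by
  rintro ⟨t, i, x⟩
  have ho : IsOpen ((fun q : ℝ × (DiscreteIndex ι × M) => q.2.1) ⁻¹' {i}) :=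
    (isOpen_discrete _).preimage (continuous_fst.comp continuous_snd)
  have heq : (uncurry fun (t : ℝ) (p : DiscreteIndex ι × M) =>
      F (DiscreteIndex.mk.symm p.1) t p.2) =ᶠ[𝓝 (t, i, x)]
      (uncurry (F (DiscreteIndex.mk.symm i)) ∘ fun q => (q.1, q.2.2)) := by
    filter_upwards [ho.mem_nhds (by simp)] with q hq
    obtain ⟨s, j, y⟩ := q
    simp only [mem_preimage, mem_singleton_iff] at hq
    subst hq
    rfl
  exact ((hF _).comp (contMDiff_fst.prodMk (contMDiff_snd.comp contMDiff_snd))).contMDiffAt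
    |>.congr_of_eventuallyEq heq

/-- **The differential of the glued map is injective** wherever the differential of the
relevant member is: the `ℝ⁰`-factor of the tangent space is trivial. [folklore] -/
theorem injective_mfderiv_familyMap {e : ι → M → N} {i : DiscreteIndex ι} {x : M}
    (hd : MDifferentiableAt I J (e (DiscreteIndex.mk.symm i)) x)
    (hinj : Injective (mfderiv I J (e (DiscreteIndex.mk.symm i)) x)) :
    Injective (mfderiv ((𝓡 0).prod I) J
      (fun p : DiscreteIndex ι × M => e (DiscreteIndex.mk.symm p.1) p.2) (i, x)) := by
  rw [(familyMap_eventuallyEq e i x).mfderiv_eq, mfderiv_comp (i, x) hd mdifferentiableAt_snd,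
    mfderiv_snd]
  intro v w h
  have h' : mfderiv I J (e (DiscreteIndex.mk.symm i)) x v.2 =
      mfderiv I J (e (DiscreteIndex.mk.symm i)) x w.2 := h
  exact Prod.ext (Subsingleton.elim (α := EuclideanSpace ℝ (Fin 0)) _ _) (hinj h')

omit [TopologicalSpace M] [TopologicalSpace N] in
/-- **The glued map of a family is injective** when the members are injective with pairwise
disjoint images. [folklore] -/
theorem injective_familyMap {e : ι → M → N} (hinj : ∀ i, Injective (e i))
    (hd : ∀ i j, i ≠ j → ∀ x y, e i x ≠ e j y) :
    Injective (fun p : DiscreteIndex ι × M => e (DiscreteIndex.mk.symm p.1) p.2) := by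
  rintro ⟨i, x⟩ ⟨j, y⟩ h
  by_cases hij : DiscreteIndex.mk.symm i = DiscreteIndex.mk.symm j
  · have hij' : i = j := DiscreteIndex.mk.symm.injective hij
    subst hij'
    exact Prod.ext rfl (hinj _ h)
  · exact absurd h (hd _ _ hij x y)

variable [I.Boundaryless] [J.Boundaryless] [FiniteDimensional ℝ EM] [FiniteDimensional ℝ EN]
  [IsManifold I ∞ M] [IsManifold J ∞ N]

/-- **A finite disjoint family of smooth embeddings is a smooth embedding of the disjoint
sum.** For smooth embeddings `e i : M → N` (`M` compact, `N` Hausdorff, both without boundary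
and modelled on finite-dimensional real vector spaces, `ι` finite) with pairwise disjoint images,
the glued map `(i, x) ↦ e i x` on `DiscreteIndex ι × M` is a smooth embedding
(`Manifold.IsSmoothEmbedding`). [folklore] -/
theorem isSmoothEmbedding_familyMap [Finite ι] [CompactSpace M] [T2Space N] {e : ι → M → N}
    (he : ∀ i, Manifold.IsSmoothEmbedding I J ∞ (e i))
    (hd : ∀ i j, i ≠ j → ∀ x y, e i x ≠ e j y) :
    Manifold.IsSmoothEmbedding ((𝓡 0).prod I) J ∞
      (fun p : DiscreteIndex ι × M => e (DiscreteIndex.mk.symm p.1) p.2) := by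
  refine isSmoothEmbedding_of_injective_of_injective_mfderiv
    (contMDiff_familyMap fun i => (he i).contMDiff) (by simp)
    (injective_familyMap (fun i => (he i).isEmbedding.injective) hd) ?_
  rintro ⟨i, x⟩
  obtain ⟨F, _, _, hF⟩ := (he (DiscreteIndex.mk.symm i)).isImmersion
  exact injective_mfderiv_familyMap ((he _).contMDiff.mdifferentiableAt (by simp))
    (Manifold.IsImmersionAtOfComplement.mfderiv_injective (hF x) (by simp))

end Glue

/-! ### Gluing a family of isotopies; ambient extension -/

section Isotopy

variable [I.Boundaryless] [J.Boundaryless] [FiniteDimensional ℝ EM] [FiniteDimensional ℝ EN]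
  [IsManifold I ∞ M] [IsManifold J ∞ N] [Finite ι] [CompactSpace M] [T2Space N]

/-- **A family of smooth isotopies with pairwise disjoint stages glues to one smooth isotopy of
the disjoint sum** `DiscreteIndex ι × M` (Hirsch, Ch. 8 §1: an isotopy of a compact
submanifold with several components). [folklore] -/
theorem exists_smoothIsotopy_familyMap {e₀ e₁ : ι → M → N}
    (F : ∀ i, SmoothIsotopy I J (e₀ i) (e₁ i))
    (hF : ∀ t i j, i ≠ j → ∀ x y, (F i).toFun t x ≠ (F j).toFun t y) :
    ∃ L : SmoothIsotopy ((𝓡 0).prod I) J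
        (fun p : DiscreteIndex ι × M => e₀ (DiscreteIndex.mk.symm p.1) p.2)
        (fun p : DiscreteIndex ι × M => e₁ (DiscreteIndex.mk.symm p.1) p.2),
      ∀ t i x, L.toFun t (DiscreteIndex.mk i, x) = (F i).toFun t x :=
  ⟨{ toFun := fun t p => (F (DiscreteIndex.mk.symm p.1)).toFun t p.2
     contMDiff := contMDiff_uncurry_familyMap fun i => (F i).contMDiff
     isSmoothEmbedding := fun t =>
       isSmoothEmbedding_familyMap (fun i => (F i).isSmoothEmbedding t) (hF t)
     map_zero := by
       funext p
       rw [(F (DiscreteIndex.mk.symm p.1)).map_zero]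
     map_one := by
       funext p
       rw [(F (DiscreteIndex.mk.symm p.1)).map_one] }, fun _ _ _ => rfl⟩

/-- **Ambient extension of an isotopy of a finite disjoint family** (Hirsch (1976), Ch. 8 §1,
Thm. 1.3, applied to the disjoint sum): let `N` be a closed manifold (compact, Hausdorff, without
boundary) and `F i`, `i : ι` finite, smooth isotopies of a compact boundaryless manifold `M` in
`N` whose stages are pairwise disjoint at every time.  Then there is an ambient isotopy `Ψ` of `N`
with `Ψ_t (e₀ i x) = F i t x` for all `i`, `x` and `-1/2 < t < 3/2`.
[cite: HirschDT1976, Ch. 8 §1, Thm. 1.3] -/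
theorem exists_ambientIsotopy_of_smoothIsotopy_family [CompactSpace N] {e₀ e₁ : ι → M → N}
    (F : ∀ i, SmoothIsotopy I J (e₀ i) (e₁ i))
    (hF : ∀ t i j, i ≠ j → ∀ x y, (F i).toFun t x ≠ (F j).toFun t y) :
    ∃ Ψ : AmbientIsotopy J N, ∀ t ∈ Ioo (-1 / 2 : ℝ) (3 / 2), ∀ i x,
      Ψ.toFun t (e₀ i x) = (F i).toFun t x := by
  obtain ⟨L, hL⟩ := exists_smoothIsotopy_familyMap F hF
  obtain ⟨Ψ, hΨ⟩ := L.exists_ambientIsotopy_comp_eq_holds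
  refine ⟨Ψ, fun t ht i x => ?_⟩
  have h := hΨ t ht (DiscreteIndex.mk i, x)
  rw [L.map_zero] at h
  exact h.trans (hL t i x)

/-- **Ambient extension, endpoint form**: under the hypotheses of
`exists_ambientIsotopy_of_smoothIsotopy_family`, the time-one diffeomorphism of the ambient
isotopy carries every `e₀ i` to `e₁ i`. [cite: HirschDT1976, Ch. 8 §1, Thm. 1.3] -/
theorem exists_ambientIsotopy_one_comp_of_smoothIsotopy_family [CompactSpace N]
    {e₀ e₁ : ι → M → N} (F : ∀ i, SmoothIsotopy I J (e₀ i) (e₁ i))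
    (hF : ∀ t i j, i ≠ j → ∀ x y, (F i).toFun t x ≠ (F j).toFun t y) :
    ∃ Ψ : AmbientIsotopy J N, (∀ i, Ψ.toFun 1 ∘ e₀ i = e₁ i) ∧
      ∀ t ∈ Ioo (-1 / 2 : ℝ) (3 / 2), ∀ i x, Ψ.toFun t (e₀ i x) = (F i).toFun t x := by
  obtain ⟨Ψ, hΨ⟩ := exists_ambientIsotopy_of_smoothIsotopy_family F hF
  refine ⟨Ψ, fun i => funext fun x => ?_, hΨ⟩
  have h := hΨ 1 ⟨by norm_num, by norm_num⟩ i x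
  rw [(F i).map_one] at h
  exact h

end Isotopy

/-! ### Families in the boundary of a compact manifold: extension over the manifold -/

section Boundary

variable [I.Boundaryless] [FiniteDimensional ℝ EM] [IsManifold I ∞ M] [Finite ι] [CompactSpace M]
  {n : ℕ} {W : Type u} [TopologicalSpace W] [T2Space W] [SecondCountableTopology W]
  [CompactSpace W] [ChartedSpace (EuclideanHalfSpace (n + 1)) W] [IsManifold (𝓡∂ (n + 1)) ∞ W]

/-- **An isotopy of a finite disjoint family in `∂W` is realised by a diffeomorphism of `W`.**
Let `W` be a compact manifold with boundary, `b` a boundary datum (`b.carrier ≅ ∂W`), and `F i`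
(`i : ι` finite) smooth isotopies of a compact boundaryless manifold `M` in the boundary manifold
`b.carrier` whose stages are pairwise disjoint at every time.  Then there are a diffeomorphism
`ψ` of `b.carrier`, diffeotopic to the identity, with `ψ ∘ e₀ i = e₁ i` for all `i` (the time-one
map of the ambient isotopy of `exists_ambientIsotopy_one_comp_of_smoothIsotopy_family`,
`AmbientIsotopy.isDiffeotopicToId`), and a diffeomorphism `Φ` of `W` extending it,
`Φ ∘ incl = incl ∘ ψ` (collar extension, `BoundaryData.diffeoExtends_of_isDiffeotopicToId_holds`):
Kosinski's *"isotopic attaching maps … extended over `M`, using the collar of `∂M`, in the usual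
way"*. [cite: Kosinski1993, VI §7, proof of (7.2)] [cite: HirschDT1976, Ch. 8 §1, Thm. 1.3] -/
theorem BoundaryData.exists_diffeomorph_comp_incl_of_smoothIsotopy_family
    (b : BoundaryData (𝓡∂ (n + 1)) W (𝓡 n)) {e₀ e₁ : ι → M → b.carrier}
    (F : ∀ i, SmoothIsotopy I (𝓡 n) (e₀ i) (e₁ i))
    (hF : ∀ t i j, i ≠ j → ∀ x y, (F i).toFun t x ≠ (F j).toFun t y) :
    ∃ (ψ : b.carrier ≃ₘ⟮𝓡 n, 𝓡 n⟯ b.carrier) (Φ : W ≃ₘ⟮𝓡∂ (n + 1), 𝓡∂ (n + 1)⟯ W),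
      Diffeomorph.IsDiffeotopicToId ψ ∧ ⇑Φ ∘ b.incl = b.incl ∘ ⇑ψ ∧ ∀ i, ⇑ψ ∘ e₀ i = e₁ i := by
  haveI : CompactSpace b.carrier := b.compactSpace_carrier
  haveI : T2Space b.carrier := b.isSmoothEmbedding.isEmbedding.t2Space
  obtain ⟨Ψ, hΨ1, -⟩ := exists_ambientIsotopy_one_comp_of_smoothIsotopy_family F hF
  have hiso : Diffeomorph.IsDiffeotopicToId (Ψ.toDiffeomorph 1) := Ψ.isDiffeotopicToId 1
  obtain ⟨Φ, hΦ⟩ :=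
    BoundaryData.diffeoExtends_of_isDiffeotopicToId_holds n W b (Ψ.toDiffeomorph 1) hiso
  exact ⟨Ψ.toDiffeomorph 1, Φ, hiso, hΦ, hΨ1⟩

/-- **Pointwise form**: under the hypotheses of
`BoundaryData.exists_diffeomorph_comp_incl_of_smoothIsotopy_family` there is a diffeomorphism
`Φ` of `W` with `Φ (incl (e₀ i x)) = incl (e₁ i x)` for all `i`, `x`.
[cite: Kosinski1993, VI §7, proof of (7.2)] -/
theorem BoundaryData.exists_diffeomorph_apply_incl_of_smoothIsotopy_family
    (b : BoundaryData (𝓡∂ (n + 1)) W (𝓡 n)) {e₀ e₁ : ι → M → b.carrier}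
    (F : ∀ i, SmoothIsotopy I (𝓡 n) (e₀ i) (e₁ i))
    (hF : ∀ t i j, i ≠ j → ∀ x y, (F i).toFun t x ≠ (F j).toFun t y) :
    ∃ Φ : W ≃ₘ⟮𝓡∂ (n + 1), 𝓡∂ (n + 1)⟯ W, ∀ i x, Φ (b.incl (e₀ i x)) = b.incl (e₁ i x) := by
  obtain ⟨ψ, Φ, -, hΦ, hψ⟩ := b.exists_diffeomorph_comp_incl_of_smoothIsotopy_family F hF
  refine ⟨Φ, fun i x => ?_⟩
  have h₁ := congrFun hΦ (e₀ i x)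
  have h₂ := congrFun (hψ i) x
  simp only [comp_apply] at h₁ h₂
  rw [h₁, h₂]

end Boundary

end Literature.Topology.FourManifolds
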